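import Literature.MathematicalPhysics.QuantumFieldTheory.Balaban1983to89.B3Op116MixedCurrency
import Literature.MathematicalPhysics.QuantumFieldTheory.Balaban1983to89.B3Ineq25Op116RegularRegion

/-!
# Bałaban, *(Higgs)₂,₃ quantum fields in a finite volume III* [B3] — INEQUALITY (2.5) p. 424 FOR THE (1.16) KERNEL ON A REGION AND ON THE TORUS
WITH A CONSTANT THAT DOES NOT DEPEND ON THE LATTICE SPACING OR THE SCALE: the hypothesis-free region member `ineq25At_op116_region` (R5) with its
displayed constant `C_G + K·(valC + derC) + holC + d·m·mixC` replaced by `C_G + K·(valCU + derCU) + holCU + d·m·mixCU(d, L, N, …; |e|s, t; n+n′)`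
— file «UniformCurrency» (the row-level form of the currency programme C1–C3)

statement-level skeleton of published theorems with citation tags; proofs where landed; nothing here is a claim about the Yang–Mills mass gap

T. Bałaban, Commun. Math. Phys. **88** (1983) 411–445 [cite: Balaban1983Higgs3], (1.16) p. 414, Prop. 1 pp. 420–421, (2.5) p. 424; part I
[cite: Balaban1982Higgs1], Prop. 2.1 p. 610, (3.14)–(3.16) pp. 614–615.  PDF held: `paper:balaban1983-higgs-2-3-quantum-fields-finite-volume`
(journal page = PDF page + 410; pp. 420–421 = `p0010.txt`–`p0011.txt`, p. 424 = `p0014.txt`).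

CITATION HEADER (lean-in-tree rule).  Cell `lit-balaban` (HOME `run/shared/lean/pub/lit-balaban/`), Phase-2 proof seat **p35** gen 29 (unit
`lit-balaban-p35`, literature-prover-lit-balaban-p35-g29-0); free-target protocol G.5-34(d) (TAKING HOME/STATUS.md 2026-08-25T05:18Z, the γ′ / torus
CURRENCY programme; row owner r15 NO OBJECTION 05:19Z).  SKELETON rows **B3.Eq2.5** / **B3.Eq1.16** (fold owner r15) — located members, no head claim:
R5's declared divergence (ii) («the coupling powers inside `valC/derC/holC` and `mixC` are NOT re-expressed») typed as UNIFORMITY IN `ε` AND `k` GIVEN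
PRINT'S SMALLNESS PARAMETERS.  USED BY NAME, never restated: p40's R5 `B3Ineq25Op116RegularRegion.ineq25At_op116_region`, p40's
`B3Ineq25Op116Smooth.ineq25At_smooth116_mono`, C1 `B3Op116KernelCurrencyTorus.{valC_currency, derC_currency, holC_currency, valCU, derCU, holCU}`,
C3 `B3Op116MixedCurrency.{mixC_currency, mixCU}`, the torus files' `valC_nonneg` / `derC_nonneg` / `holC_nonneg` / `mixC_nonneg`, p33's
`smoothConst_pos`, r14's `interior_univ`, the steward's `isBigBlockUnion_univ`.

## What is printed (verbatim)

[B3] (2.5) p. 424 [PDF 14]: *"‖h(an operator δG_k(Ω,Ω₂,B̃) or (1.16))h′‖_{1,α} ≤ O(e^{−δ₀dist(Ω₂,∂Ω)} or (e(L^kε)p(L^kε))^{n+n′})e^{−δ₀dist(supp h, supp h′)}"*.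
Prop. 1, pp. 420–421 [PDF 10–11]: *"The constant O(1) depends on α₀, n̄ … and is independent of ε, k, the domains Ω, Ω₁, Ω₂, the vector field B̃ (if
they satisfy the conditions mentioned previously)."*

## What this file proves, and how

**`ineq25At_op116_region_uniform`**: R5's `ineq25At_op116_region` VERBATIM (∃ `E₀` ∀ charge ∃ `K₀min` ∀ `0 ≤ α < 1` ∀ `K₀ ≥ K₀min` ∃ `t, δ₁, δ₀, C,
C_M, C_H, C_G` ∀ torus (`d`, `L`, `K₀ ∣ M`) ∀ scale `1 ≤ k ≤ K` (`L^kε ≤ 1`) ∀ nested big-block unions `Ω₂ ⊆ Ω` ∀ backgrounds in R5's regime … the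
`Ineq25At` of the carrier `sect2Smooth116`) with ONE MORE regime hypothesis — the (I.2.23) smallness `L^k·δ_A·|e| ≤ t` of the perturbation `Ã` itself
(R5 asks it for `B̃` and `Ã+B̃` only; print: `Ã` is the smooth `a_kG_kQ_k^*A′`, p. 412) — and the CONSTANT
`C_G + K(d,m,c₁,c₂+2c₁)·(valCU + derCU)(d, L, N, C, δ₁, a, |e|s, t; n+n′) + holCU(d, L, N, C, C_H, δ₁, a, α, |e|s, t; n+n′−1) + d·m·mixCU(d, L, N, C, C_M,
δ₁, a, |e|s, t; n+n′)`: a function of the fixed data `(d, L, N, m, c₁, c₂, a, α, n, n′)`, of the ∃-constants `(t, δ₁, C, C_M, C_H, C_G)` (chosen before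
the lattice) and of print's parameter `|e|s = |e|·sup|Ã|` — and of NOTHING ELSE: no `ε`, no `k`, no `Ω`, no field.  Proof: R5's member, the four
currency bounds of C1/C3 at `τ = t`, and p40's monotonicity of `Ineq25At` in its constant (`ineq25At_smooth116_mono`).
**`ineq25At_op116_torus_uniform`**: the case `Ω = T_ε` (every site deep, the support clause void).

## Honest scope

The constant still carries `|e|s` (print's `e(L^kε)·sup|Ã| ≤ e(L^kε)p(L^kε)`, p. 412) as a parameter, exactly as p40's `collarKU` does; expressing it
and `t` through `e(L^kε)`, `p(L^kε)` (p. 433) and absorbing the logarithm (p40's `B3Ineq25Op116PrintCurrency`) is not repeated here; the rate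
`min δ₀ (δ₁/(4L)^{n+n′+1})` is R5's (produced after `δ₁`, the (2.5) lineage's quantifier order).  Everything else — regime, thresholds `n, n′ ≥ 1`,
`n + n′ > d`, `0 ≤ α < 1` — as in R5.  No `def`, no new named fact, no `sorry`; axioms standard.  Value = the located currency sentence of Prop. 1
for the assembled (2.5)/(1.16) members — NOT summit progress and nothing about the Yang–Mills mass gap.
-/

noncomputable section

open scoped BigOperators

namespace Literature.MathematicalPhysics.QuantumFieldTheory.Balaban1983to89.B3Ineq25Op116UniformCurrency

open HiggsLattice (ChargeData)
open B1Eq230FluctCov (Ix)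
open B1TorusCubeCover (half)
open B1TorusRegionHSizes (IsBigBlockUnion isBigBlockUnion_univ)
open B3Ineq210RegularRegion (Interior interior_univ)
open B3Ineq31SmoothLocalization (smoothConst smoothConst_pos)
open B3Ineq25Op116Smooth (sect2Smooth116 ineq25At_smooth116_mono)
open B3Op116DKernelRegularTorus (valC derC valC_nonneg derC_nonneg)
open B3Op116HolderKernelRegularTorus (holC holC_nonneg)
open B3Op116MixedKernelRegularTorus (mixC mixC_nonneg)
open B3Op116RegionSources (DeepBlk)
open B3Ineq25Op116RegularRegion (ineq25At_op116_region)
open B3Op116KernelCurrencyTorus (valCU derCU holCU valC_currency derC_currency holC_currency)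
open B3Op116MixedCurrency (mixCU mixC_currency)

variable {N : ℕ}

/-- the uniform constant of the assembled region/torus member: `C_G + K·(valCU + derCU) + holCU + d·m·mixCU` — a function of the fixed data, the
∃-constants and `σ = |e|s`, `t`; NO lattice argument. [cite: Balaban1983Higgs3, (2.5) p.424, Prop. 1 pp.420–421] -/
def unifC (d : ℕ) (L : ℝ) (N m : ℕ) (c₁ c₂ Cst CM CH CG δ₁ a α σ t : ℝ) (n n' : ℕ) : ℝ :=
  CG + (smoothConst d m c₁ (c₂ + 2 * c₁) * (valCU d L N Cst δ₁ a σ t (n + n') + derCU d L N Cst δ₁ a σ t (n + n'))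
    + (holCU d L N Cst CH δ₁ a α σ t (n + n' - 1) + (d : ℝ) * m * mixCU d L N Cst CM δ₁ a σ t (n + n')))

set_option maxHeartbeats 800000 in
/-- **INEQUALITY (2.5) OF [B3], THE (1.16) ALTERNATIVE, ON A REGION, WITH A CONSTANT INDEPENDENT OF `ε` AND `k`** (Prop. 1 pp. 420–421: *"independent
of ε, k, the domains Ω, Ω₁, Ω₂, the vector field B̃"*).  R5's `ineq25At_op116_region` with the additional regime hypothesis `L^k·δ_A·|e| ≤ t` on `Ã`
and the constant `unifC(d, L, N, m, c₁, c₂, C, C_M, C_H, C_G, δ₁, a, α, |e|s, t; n, n′)` in place of R5's displayed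
`C_G + K·(valC + derC) + holC + d·m·mixC` (functions of the lattice as written): for `d ≥ 1`, `L ≥ 2`, `a > 0`, `m² > 0`, `c ≥ 0`, `m`, `c₁, c₂ ≥ 0`,
`n, n′ ≥ 1`, `n + n′ > d`: ∃ `E₀ > 0` ∀ charge (`e² ≤ E₀`) ∃ `K₀min` ∀ `0 ≤ α < 1` ∀ `K₀ ≥ K₀min` ∃ `t, δ₁, δ₀, C, C_M, C_H, C_G` ∀ torus ∀ scale ∀ `Ω₂ ⊆ Ω`
∀ backgrounds in R5's regime with `L^kδ_A|e| ≤ t` ∀ `r₀` ∀ `(e_R, p_R)` with `L^kε ≤ e_Rp_R`: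
`(sect2Smooth116 … e_R p_R).Ineq25At n n′ α (min δ₀ (δ₁/(4L)^{n+n′+1})) (unifC d L N m c₁ c₂ C C_M C_H C_G δ₁ a α (|e|s) t n n′)`.
[cite: Balaban1983Higgs3, (2.5) p.424, (1.16) p.414, Prop. 1 pp.420–421, p.412] [cite: Balaban1982Higgs1, Prop. 2.1 p.610] -/
theorem ineq25At_op116_region_uniform (d L : ℕ) (hd : 1 ≤ d) (hL : 2 ≤ L) {a : ℝ} (ha : 0 < a) {msq : ℝ} (hmsq : 0 < msq)
    {c : ℝ} (hc : 0 ≤ c) (N m : ℕ) {c₁ c₂ : ℝ} (hc₁ : 0 ≤ c₁) (hc₂ : 0 ≤ c₂)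
    (n n' : ℕ) (hn : 1 ≤ n) (hn' : 1 ≤ n') (hdn : d < n + n') :
    ∃ E₀ : ℝ, 0 < E₀ ∧ ∀ (C : ChargeData N), C.e ^ 2 ≤ E₀ →
      ∃ K₀min : ℕ, ∀ {α : ℝ}, 0 ≤ α → α < 1 → ∀ K₀ : ℕ, K₀min ≤ K₀ →
      ∃ t δ₁ δ₀ Cst CM CH CG : ℝ, 0 < t ∧ 0 < δ₁ ∧ δ₁ ≤ 1 ∧ 0 < δ₀ ∧ 0 ≤ Cst ∧ 0 ≤ CM ∧ 0 ≤ CH ∧ 0 ≤ CG ∧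
      ∀ (P : HiggsLattice.Params) (hP1 : 1 < P.L), P.d = d → P.L = L → K₀ ∣ P.M →
      ∀ {k : ℕ}, 1 ≤ k → k ≤ P.K → (∀ μ, 3 * half P k K₀ ≤ P.sitesPerDir 0 μ) → P.mesh k ≤ 1 →
      ∀ (Ω Ω₂ : Finset (HiggsLattice.Site P 0)), IsBigBlockUnion k K₀ Ω → IsBigBlockUnion k K₀ Ω₂ → Ω₂ ⊆ Ω →
      ∀ (A B : HiggsLattice.VecField P 0) {δB δAB δA s : ℝ}, 0 ≤ δB → 0 ≤ δAB → 0 ≤ δA → 0 ≤ s →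
        (∀ z ∈ Ω, ∀ μ ν : Fin P.d, |B ⟨z.shift ν, μ⟩ - B ⟨z, μ⟩| ≤ δB) →
        (∀ z ∈ Ω, ∀ μ ν : Fin P.d, |(A + B) ⟨z.shift ν, μ⟩ - (A + B) ⟨z, μ⟩| ≤ δAB) →
        (∀ (z : HiggsLattice.Site P 0) (μ ν : Fin P.d), |A ⟨z.shift ν, μ⟩ - A ⟨z, μ⟩| ≤ δA) →
        (P.L : ℝ) ^ k * δB * |C.e| ≤ t → (P.L : ℝ) ^ k * δAB * |C.e| ≤ t → (P.L : ℝ) ^ k * δA * |C.e| ≤ t →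
        (P.L : ℝ) ^ k * δB ≤ c * |C.e| →
        (∀ b : HiggsLattice.PBond P 0, |A b| ≤ s) → P.mesh k * (|C.e| * s) ≤ 1 →
        (∀ b : HiggsLattice.PBond P 0, A b ≠ 0 → DeepBlk k K₀ Ω b.src ∧ DeepBlk k K₀ Ω b.tgt) →
      ∀ (r₀ : ℕ) {eR pR : ℝ}, 0 ≤ eR * pR → P.mesh k ≤ eR * pR → Ix N →
        (sect2Smooth116 hP1 C Ω Ω₂ A B msq a k K₀ r₀ m c₁ c₂ eR pR).Ineq25At n n' α
          (min δ₀ (δ₁ / (4 * (P.L : ℝ)) ^ (n + n' + 1)))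
          (unifC d (L : ℝ) N m c₁ c₂ Cst CM CH CG δ₁ a α (|C.e| * s) t n n') := by
  obtain ⟨E₀, hE₀, hR⟩ := ineq25At_op116_region d L hd hL ha hmsq hc N m hc₁ hc₂ n n' hn hn' hdn
  refine ⟨E₀, hE₀, fun C heC => ?_⟩
  obtain ⟨K₀min, hK⟩ := hR C heC
  refine ⟨K₀min, fun {α} hα0 hα1 K₀ hK₀ => ?_⟩
  obtain ⟨t, δ₁, δ₀, Cst, CM, CH, CG, ht, hδ₁, hδ₁1, hδ₀, hCst, hCM, hCH, hCG, h⟩ := hK hα0 hα1 K₀ hK₀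
  refine ⟨t, δ₁, δ₀, Cst, CM, CH, CG, ht, hδ₁, hδ₁1, hδ₀, hCst, hCM, hCH, hCG, ?_⟩
  intro P hP1 hPd hPL hK₀M k hk hkK h3h hmesh Ω Ω₂ hΩ hΩ₂ hsub A B δB δAB δA s hδB hδAB hδA hs hregB hregAB hregA htB htAB htA hcB hA ht1
    hAS r₀ eR pR ht0 htm i₀
  -- R5's member with its displayed constant
  have hmain := h P hP1 hPd hPL hK₀M hk hkK h3h hmesh Ω Ω₂ hΩ hΩ₂ hsub A B hδB hδAB hδA hs hregB hregAB hregA htB htAB hcB hA ht1 hAS r₀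
    ht0 htm i₀
  have hL1' : 1 < P.L := hP1
  have hε := P.mesh_pos 0
  have hdP : P.d < n + n' := by rw [hPd]; exact hdn
  have hM : (P.d : ℝ) < ((n + n' : ℕ) : ℝ) := by exact_mod_cast hdP
  have hτ : (P.L : ℝ) ^ k * (|C.e| * δA) ≤ t := by
    calc (P.L : ℝ) ^ k * (|C.e| * δA) = (P.L : ℝ) ^ k * δA * |C.e| := by ring
      _ ≤ t := htA
  -- the four currency bounds (C1, C3) at τ = t
  have hv := valC_currency (N := N) (C := C) hL1' hk hmesh ha hδ₁ hCst hs hδA hτ (n + n') (by linarith)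
  have hdd := derC_currency (N := N) (C := C) hL1' hk hmesh ha hδ₁ hCst hs hδA hτ (n + n') (by linarith)
  have hdH : (P.d : ℝ) < 1 + ((n + n' - 1 + 1 : ℕ) : ℝ) - α := by rw [show n + n' - 1 + 1 = n + n' by omega]; linarith
  have hh := holC_currency (N := N) (C := C) hL1' hk hmesh ha hδ₁ hCst hs hδA hτ hα1 hCH (n + n' - 1) hdH
  have hm := mixC_currency (N := N) (C := C) hL1' hk hmesh ha hδ₁ hCst hCM hs hδA hτ hdP
  -- the sign of R5's constant
  have hCV := valC_nonneg (P := P) (N := N) (C := C) (k := k) (a := a) hL1' hδ₁ hCst hs hδA (n + n') (by linarith)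
  have hCD := derC_nonneg (P := P) (N := N) (C := C) (k := k) (a := a) hL1' hδ₁ hCst hs hδA (n + n') (by linarith)
  have hCH0 : 0 ≤ P.mesh 0 ^ P.d * CH := mul_nonneg (pow_nonneg hε.le P.d) hCH
  have hCH' := holC_nonneg (P := P) (N := N) (C := C) (k := k) (a := a) (cH := P.mesh 0 ^ P.d * CH) hL1' hδ₁ hCst hs hδA hα1 hCH0
    (n + n' - 1) hdH
  have hCM' := mixC_nonneg (P := P) (N := N) (C := C) (k := k) hL1' hδ₁ hCst hCM ha.le hs hδA hdP
  have hKs := smoothConst_pos P.d m hc₁ (by positivity : 0 ≤ c₂ + 2 * c₁)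
  have hC0 : 0 ≤ CG + (smoothConst P.d m c₁ (c₂ + 2 * c₁) *
        (valC P N C k a δ₁ Cst s δA (n + n') + derC P N C k a δ₁ Cst s δA (n + n'))
      + (holC P N C k a δ₁ Cst s δA α (P.mesh 0 ^ P.d * CH) (n + n' - 1) + P.d * m * mixC P N C k a δ₁ Cst CM s δA (n + n'))) := by
    positivity
  -- the comparison of the two constants
  have hdm : (0 : ℝ) ≤ (P.d : ℝ) * m := by positivity
  have hle : CG + (smoothConst P.d m c₁ (c₂ + 2 * c₁) *
        (valC P N C k a δ₁ Cst s δA (n + n') + derC P N C k a δ₁ Cst s δA (n + n'))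
      + (holC P N C k a δ₁ Cst s δA α (P.mesh 0 ^ P.d * CH) (n + n' - 1) + P.d * m * mixC P N C k a δ₁ Cst CM s δA (n + n')))
      ≤ unifC d (L : ℝ) N m c₁ c₂ Cst CM CH CG δ₁ a α (|C.e| * s) t n n' := by
    subst hPd; subst hPL
    unfold unifC
    exact add_le_add le_rfl (add_le_add (mul_le_mul_of_nonneg_left (add_le_add hv hdd) hKs.le)
      (add_le_add hh (mul_le_mul_of_nonneg_left hm hdm)))
  exact ineq25At_smooth116_mono le_rfl hle hC0 ht0 hmain

/-- **THE TORUS CASE `Ω = T_ε` WITH THE UNIFORM CONSTANT**: every site of the torus is deep (`interior_univ`), so the support clause on `Ã` is void;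
the same conclusion for the carrier `sect2Smooth116 hP1 C T_ε Ω₂ …` and every big-block union `Ω₂`, constant `unifC(d, L, N, …; |e|s, t; n, n′)`.
[cite: Balaban1983Higgs3, (2.5) p.424, (1.16) p.414, Prop. 1 pp.420–421] -/
theorem ineq25At_op116_torus_uniform (d L : ℕ) (hd : 1 ≤ d) (hL : 2 ≤ L) {a : ℝ} (ha : 0 < a) {msq : ℝ} (hmsq : 0 < msq)
    {c : ℝ} (hc : 0 ≤ c) (N m : ℕ) {c₁ c₂ : ℝ} (hc₁ : 0 ≤ c₁) (hc₂ : 0 ≤ c₂)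
    (n n' : ℕ) (hn : 1 ≤ n) (hn' : 1 ≤ n') (hdn : d < n + n') :
    ∃ E₀ : ℝ, 0 < E₀ ∧ ∀ (C : ChargeData N), C.e ^ 2 ≤ E₀ →
      ∃ K₀min : ℕ, ∀ {α : ℝ}, 0 ≤ α → α < 1 → ∀ K₀ : ℕ, K₀min ≤ K₀ →
      ∃ t δ₁ δ₀ Cst CM CH CG : ℝ, 0 < t ∧ 0 < δ₁ ∧ δ₁ ≤ 1 ∧ 0 < δ₀ ∧ 0 ≤ Cst ∧ 0 ≤ CM ∧ 0 ≤ CH ∧ 0 ≤ CG ∧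
      ∀ (P : HiggsLattice.Params) (hP1 : 1 < P.L), P.d = d → P.L = L → K₀ ∣ P.M →
      ∀ {k : ℕ}, 1 ≤ k → k ≤ P.K → (∀ μ, 3 * half P k K₀ ≤ P.sitesPerDir 0 μ) → P.mesh k ≤ 1 →
      ∀ (Ω₂ : Finset (HiggsLattice.Site P 0)), IsBigBlockUnion k K₀ Ω₂ →
      ∀ (A B : HiggsLattice.VecField P 0) {δB δAB δA s : ℝ}, 0 ≤ δB → 0 ≤ δAB → 0 ≤ δA → 0 ≤ s →
        (∀ (z : HiggsLattice.Site P 0) (μ ν : Fin P.d), |B ⟨z.shift ν, μ⟩ - B ⟨z, μ⟩| ≤ δB) →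
        (∀ (z : HiggsLattice.Site P 0) (μ ν : Fin P.d), |(A + B) ⟨z.shift ν, μ⟩ - (A + B) ⟨z, μ⟩| ≤ δAB) →
        (∀ (z : HiggsLattice.Site P 0) (μ ν : Fin P.d), |A ⟨z.shift ν, μ⟩ - A ⟨z, μ⟩| ≤ δA) →
        (P.L : ℝ) ^ k * δB * |C.e| ≤ t → (P.L : ℝ) ^ k * δAB * |C.e| ≤ t → (P.L : ℝ) ^ k * δA * |C.e| ≤ t →
        (P.L : ℝ) ^ k * δB ≤ c * |C.e| →
        (∀ b : HiggsLattice.PBond P 0, |A b| ≤ s) → P.mesh k * (|C.e| * s) ≤ 1 →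
      ∀ (r₀ : ℕ) {eR pR : ℝ}, 0 ≤ eR * pR → P.mesh k ≤ eR * pR → Ix N →
        (sect2Smooth116 hP1 C Finset.univ Ω₂ A B msq a k K₀ r₀ m c₁ c₂ eR pR).Ineq25At n n' α
          (min δ₀ (δ₁ / (4 * (P.L : ℝ)) ^ (n + n' + 1)))
          (unifC d (L : ℝ) N m c₁ c₂ Cst CM CH CG δ₁ a α (|C.e| * s) t n n') := by
  obtain ⟨E₀, hE₀, hR⟩ := ineq25At_op116_region_uniform d L hd hL ha hmsq hc N m hc₁ hc₂ n n' hn hn' hdn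
  refine ⟨E₀, hE₀, fun C heC => ?_⟩
  obtain ⟨K₀min, hK⟩ := hR C heC
  refine ⟨K₀min, fun {α} hα0 hα1 K₀ hK₀ => ?_⟩
  obtain ⟨t, δ₁, δ₀, Cst, CM, CH, CG, ht, hδ₁, hδ₁1, hδ₀, hCst, hCM, hCH, hCG, h⟩ := hK hα0 hα1 K₀ hK₀
  refine ⟨t, δ₁, δ₀, Cst, CM, CH, CG, ht, hδ₁, hδ₁1, hδ₀, hCst, hCM, hCH, hCG, ?_⟩
  intro P hP1 hPd hPL hK₀M k hk hkK h3h hmesh Ω₂ hΩ₂ A B δB δAB δA s hδB hδAB hδA hs hregB hregAB hregA htB htAB htA hcB hA ht1 r₀ eR pR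
    ht0 htm i₀
  exact h P hP1 hPd hPL hK₀M hk hkK h3h hmesh Finset.univ Ω₂ isBigBlockUnion_univ hΩ₂ (Finset.subset_univ _) A B hδB hδAB hδA hs
    (fun z _ μ ν => hregB z μ ν) (fun z _ μ ν => hregAB z μ ν) hregA htB htAB htA hcB hA ht1
    (fun b _ => ⟨fun z _ z' _ => interior_univ z', fun z _ z' _ => interior_univ z'⟩) r₀ ht0 htm i₀

end Literature.MathematicalPhysics.QuantumFieldTheory.Balaban1983to89.B3Ineq25Op116UniformCurrency
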